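import Literature.Analysis.Complex.JensenPolynomialHyperbolicity
import Literature.Analysis.Complex.RoucheTheorem
import HarnessLib

/-!
# Effective Craven–Csordas convergence of the scaled Jensen polynomials and the detection of an
# isolated non-real zero (quantitative Hurwitz) (all proved)

Trunk T-CA (`Literature/Analysis/Complex`), namespace `Literature.Analysis.Complex.JensenDetection`.
Companion of `JensenPolynomialHyperbolicity.lean` (namespace `Literature.Analysis.Complex.PolyaSchur`),
whose `tendstoLocallyUniformly_jensenPoly_scaled` is the qualitative statement
[CravenCsordas1989, Lemma 2.2, p. 244]: for an entire `F(w) = Σ γⱼ wʲ/j!`, `J^{d,0}_γ(z/d) → F(z)`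
locally uniformly (`J^{d,n}_γ = Literature.NumberTheory.LFunctions.jensenPoly γ d n`,
[GORZPNAS2019, §1]). This file makes the rate EXPLICIT and draws the Hurwitz-type consequence with
an explicit degree. Everything is RH-free analysis of an arbitrary real sequence `γ`; nothing here
concerns `ξ` (the `ξ` instance is `Literature/Barriers/RiemannHypothesis/JensenPolynomialsRowZeroObstruction.lean`).

## Contents (all proved; no definitions)

* `one_sub_descFactorial_div_pow_le` — the elementary inequality
  `1 - d(d-1)⋯(d-j+1)/dʲ ≤ j(j-1)/(2d)` (all `j`, `d ≥ 1`; Weierstrass product inequality).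
* the weighted majorant `E_γ(R) := Σⱼ j(j-1)|γⱼ|Rʲ/j!` (`= R²M″(R)` for the majorant series
  `M(R) = Σ|γⱼ|Rʲ/j!`; written out as a `tsum` in every statement, no definition is introduced):
  `summable_majorantErr` (converges at `R` whenever the majorant converges at `2R`).
* `norm_jensenPoly_scaled_sub_le` — **effective Craven–Csordas**:
  `‖J^{d,0}_γ(z/d) - F(z)‖ ≤ E_γ(R) / (2d)` on `‖z‖ ≤ R` [CravenCsordas1989, Lemma 2.2 is
  the `o(1)` statement; the rate is the termwise bound above].
* `not_splits_jensenPoly_of_offLine_zero` — **detection degree** (quantitative Hurwitz,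
  [Conway1978, Ch. VII Thm. 2.5], via the tree's Rouché theorem
  `Literature.Analysis.Complex.Rouche.existsUnique_zero_of_norm_sub_lt`): an isolated simple non-real
  zero `z₀` of `F` (isolation radius `ρ ≤ |Im z₀|`, modulus floor `m` on the circle) forces
  `J^{d,0}_γ` NON-hyperbolic for every `d ≥ 1` with `E_γ(‖z₀‖+ρ)/(2d) < m` — the
  effective converse direction of the Pólya–Schur/Craven–Csordas limit theorem.

Provenance: cell rh-jensen (D-0074 GROUP I, negation lens round 2, `NegationLensR2Sketch.lean`,
planner-rh-jensen-idea-2-g2-0, 2026-08-26), landed by prover-rh-jensen-eng-2-g2-0. AI-produced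
formalisation; AI review is weaker than expert review.

## References
* [CravenCsordas1989] T. Craven, G. Csordas, Pacific J. Math. 136 (1989) 241–260, Lemma 2.2.
* [Conway1978] J. B. Conway, *Functions of One Complex Variable I*, Ch. VII Thm. 2.5 (Hurwitz),
  Ch. V §3 (Rouché).
* [GORZPNAS2019] M. Griffin, K. Ono, L. Rolen, D. Zagier, PNAS 116 (2019) 11103–11110, §1.
-/

open Polynomial Complex Filter Topology Metric Set
open scoped ComplexConjugate Nat

namespace Literature.Analysis.Complex.JensenDetection

open Literature.NumberTheory.LFunctions Literature.Analysis.Complex.PolyaSchur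
  Literature.Analysis.Complex

/-! ## The elementary inequality -/

/-- `1 - d(d-1)⋯(d-j+1)/dʲ ≤ j(j-1)/(2d)` for `d ≥ 1` and every `j` (for `j > d` the left side is
`1` and `j(j-1) ≥ (d+1)d ≥ 2d`). Weierstrass product inequality, by induction on `j`; the
quantitative form of `u_d(j) → 1` in the proof of Craven–Csordas' Lemma 2.2.
[cite: CravenCsordas1989, proof of Lemma 2.2] -/
theorem one_sub_descFactorial_div_pow_le {d : ℕ} (hd : 0 < d) (j : ℕ) :
    1 - (d.descFactorial j : ℝ) / (d : ℝ) ^ j ≤ (j : ℝ) * ((j : ℝ) - 1) / (2 * d) := by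
  have hd0 : (0 : ℝ) < d := by exact_mod_cast hd
  have key : ∀ j : ℕ, j ≤ d →
      1 - (j : ℝ) * ((j : ℝ) - 1) / (2 * d) ≤ (d.descFactorial j : ℝ) / (d : ℝ) ^ j := by
    intro j
    induction j with
    | zero => intro _; simp
    | succ j ih =>
      intro hj
      have hj' : j ≤ d := Nat.le_of_succ_le hj
      have ih' := ih hj'
      have hc : 0 ≤ (j : ℝ) * ((j : ℝ) - 1) / (2 * d) := by
        rcases Nat.eq_zero_or_pos j with rfl | hj1
        · simp
        · have h1 : (1 : ℝ) ≤ j := by exact_mod_cast hj1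
          exact div_nonneg (mul_nonneg (by positivity) (by linarith)) (by positivity)
      have ha : 0 ≤ 1 - (j : ℝ) / d := by
        rw [sub_nonneg, div_le_one hd0]; exact_mod_cast hj'
      have hjd : 0 ≤ (j : ℝ) / d := by positivity
      have hsplit : (((d - j : ℕ) : ℝ) * (d.descFactorial j : ℝ)) / ((d : ℝ) ^ j * d)
          = (1 - (j : ℝ) / d) * ((d.descFactorial j : ℝ) / (d : ℝ) ^ j) := by
        rw [Nat.cast_sub hj']
        field_simp
      rw [Nat.descFactorial_succ, Nat.cast_mul, pow_succ, hsplit]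
      calc 1 - ((j + 1 : ℕ) : ℝ) * (((j + 1 : ℕ) : ℝ) - 1) / (2 * d)
          = 1 - (j : ℝ) * ((j : ℝ) - 1) / (2 * d) - (j : ℝ) / d := by push_cast; ring
        _ ≤ (1 - (j : ℝ) / d) * (1 - (j : ℝ) * ((j : ℝ) - 1) / (2 * d)) := by
            nlinarith [mul_nonneg hjd hc]
        _ ≤ (1 - (j : ℝ) / d) * ((d.descFactorial j : ℝ) / (d : ℝ) ^ j) :=
            mul_le_mul_of_nonneg_left ih' ha
  by_cases hjd : j ≤ d
  · linarith [key j hjd]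
  · push Not at hjd
    rw [Nat.descFactorial_eq_zero_iff_lt.2 hjd, Nat.cast_zero, zero_div, sub_zero]
    have h1 : (d : ℝ) + 1 ≤ j := by exact_mod_cast hjd
    have h2 : (1 : ℝ) ≤ d := by exact_mod_cast hd
    rw [le_div_iff₀ (by positivity)]
    nlinarith

/-! ## Effective Craven–Csordas -/

/-- `J^{d,0}_γ(z/d) = Σⱼ u_d(j) γⱼ zʲ/j!` with `u_d(j) = d(d-1)⋯(d-j+1)/dʲ` (finite sum written as a
`HasSum`; the computation inside `tendstoLocallyUniformly_jensenPoly_scaled`, isolated).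
[cite: CravenCsordas1989, proof of Lemma 2.2] -/
theorem hasSum_jensenPoly_scaled (γ : ℕ → ℝ) {d : ℕ} (hd : 0 < d) (z : ℂ) :
    HasSum (fun j => (((d.descFactorial j : ℝ) / (d : ℝ) ^ j : ℝ) : ℂ) *
        ((γ j : ℂ) / (j ! : ℂ) * z ^ j))
      (aeval (z / d) (jensenPoly γ d 0)) := by
  have hd0' : (d : ℂ) ≠ 0 := by exact_mod_cast hd.ne'
  have hfin : ∀ j ∉ Finset.range (d + 1),
      (((d.descFactorial j : ℝ) / (d : ℝ) ^ j : ℝ) : ℂ) * ((γ j : ℂ) / (j ! : ℂ) * z ^ j) = 0 :=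
    fun j hj => by
      have hj : d < j := by simpa using hj
      simp [Nat.descFactorial_eq_zero_iff_lt.2 hj]
  convert hasSum_sum_of_ne_finset_zero (L := SummationFilter.unconditional ℕ) hfin using 1
  simp only [jensenPoly, map_sum, map_mul, aeval_C, map_pow, aeval_X, zero_add]
  refine Finset.sum_congr rfl fun j _ => ?_
  have hjf : (j ! : ℂ) ≠ 0 := by exact_mod_cast Nat.factorial_ne_zero j
  simp only [Nat.descFactorial_eq_factorial_mul_choose, Nat.cast_mul, Complex.ofReal_div,
    Complex.ofReal_mul, Complex.ofReal_natCast, Complex.ofReal_pow, Complex.coe_algebraMap]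
  field_simp
  rw [div_pow, mul_assoc, div_mul_cancel₀ _ (pow_ne_zero _ hd0')]

/-- `j(j-1) ≤ 2·2ʲ`. [folklore] -/
private theorem cast_mul_sub_one_le_two_pow (j : ℕ) : (j : ℝ) * ((j : ℝ) - 1) ≤ 2 * 2 ^ j := by
  induction j with
  | zero => simp
  | succ n ih =>
    push_cast
    have h2 : (n : ℝ) ≤ 2 ^ n := by exact_mod_cast Nat.lt_two_pow_self.le
    nlinarith [h2, ih, pow_succ (2 : ℝ) n]

/-- `0 ≤ j(j-1)` for naturals `j`. [folklore] -/
private theorem cast_mul_sub_one_nonneg (j : ℕ) : 0 ≤ (j : ℝ) * ((j : ℝ) - 1) := by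
  rcases Nat.eq_zero_or_pos j with rfl | hj1
  · simp
  · have h1 : (1 : ℝ) ≤ j := by exact_mod_cast hj1
    exact mul_nonneg (by positivity) (by linarith)

/-- The weighted majorant converges wherever the majorant converges at the doubled radius — in
particular everywhere for an entire `F` (the majorant-series convergence used in the proof of
Craven–Csordas' Lemma 2.2). [cite: CravenCsordas1989, proof of Lemma 2.2] -/
theorem summable_majorantErr {γ : ℕ → ℝ}
    (hsum : ∀ R : ℝ, 0 ≤ R → Summable fun j => |γ j| / (j ! : ℝ) * R ^ j) {R : ℝ} (hR : 0 ≤ R) :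
    Summable fun j : ℕ => ((j : ℝ) * ((j : ℝ) - 1)) * (|γ j| / (j ! : ℝ) * R ^ j) := by
  refine ((hsum (2 * R) (by positivity)).mul_left 2).of_nonneg_of_le (fun j => ?_) (fun j => ?_)
  · exact mul_nonneg (cast_mul_sub_one_nonneg j) (by positivity)
  · calc ((j : ℝ) * ((j : ℝ) - 1)) * (|γ j| / (j ! : ℝ) * R ^ j)
        ≤ (2 * 2 ^ j) * (|γ j| / (j ! : ℝ) * R ^ j) :=
          mul_le_mul_of_nonneg_right (cast_mul_sub_one_le_two_pow j) (by positivity)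
      _ = 2 * (|γ j| / (j ! : ℝ) * (2 * R) ^ j) := by rw [mul_pow]; ring

/-- **Effective Craven–Csordas.** If `F(w) = Σ γⱼ wʲ/j!` on `ℂ` then for `‖z‖ ≤ R` and `d ≥ 1`,
`‖J^{d,0}_γ(z/d) - F(z)‖ ≤ E_γ(R)/(2d)` (given summability of the weighted majorant at `R`, which
holds whenever the majorant converges at `2R`). Proof: termwise `|u_d(j) - 1| ≤ j(j-1)/(2d)`
(`one_sub_descFactorial_div_pow_le`). [cite: CravenCsordas1989, Lemma 2.2 (the `o(1)` statement)] -/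
theorem norm_jensenPoly_scaled_sub_le {γ : ℕ → ℝ} {F : ℂ → ℂ}
    (hF : ∀ w : ℂ, HasSum (fun j => (γ j : ℂ) / (j ! : ℂ) * w ^ j) (F w))
    {d : ℕ} (hd : 0 < d) {R : ℝ} {z : ℂ} (hz : ‖z‖ ≤ R)
    (hS : Summable fun j : ℕ => ((j : ℝ) * ((j : ℝ) - 1)) * (|γ j| / (j ! : ℝ) * R ^ j)) :
    ‖aeval (z / d) (jensenPoly γ d 0) - F z‖ ≤
      (∑' j : ℕ, ((j : ℝ) * ((j : ℝ) - 1)) * (|γ j| / (j ! : ℝ) * R ^ j)) / (2 * d) := by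
  have hR : 0 ≤ R := (norm_nonneg z).trans hz
  set u : ℕ → ℝ := fun j => (d.descFactorial j : ℝ) / (d : ℝ) ^ j with hu
  have hg := hasSum_jensenPoly_scaled γ hd z
  have hdiff : HasSum (fun j => (((u j : ℝ) : ℂ) - 1) * ((γ j : ℂ) / (j ! : ℂ) * z ^ j))
      (aeval (z / d) (jensenPoly γ d 0) - F z) := by
    have hfun : (fun j => (((u j : ℝ) : ℂ) - 1) * ((γ j : ℂ) / (j ! : ℂ) * z ^ j)) = fun j =>
        ((u j : ℝ) : ℂ) * ((γ j : ℂ) / (j ! : ℂ) * z ^ j) - (γ j : ℂ) / (j ! : ℂ) * z ^ j := by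
      funext j; ring
    rw [hfun]
    exact hg.sub (hF z)
  have hb : HasSum (fun j : ℕ => ((j : ℝ) * ((j : ℝ) - 1)) / (2 * d) * (|γ j| / (j ! : ℝ) * R ^ j))
      ((∑' j : ℕ, ((j : ℝ) * ((j : ℝ) - 1)) * (|γ j| / (j ! : ℝ) * R ^ j)) / (2 * d)) := by
    have h := (hS.hasSum).div_const (2 * (d : ℝ))
    refine h.congr_fun fun j => ?_
    ring
  refine hdiff.norm_le_of_bounded hb fun j => ?_
  rw [norm_mul, ← Complex.ofReal_one, ← Complex.ofReal_sub, Complex.norm_real, Real.norm_eq_abs]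
  have h01 := descFactorial_div_pow_mem_Icc d j
  have h1 : |u j - 1| ≤ (j : ℝ) * ((j : ℝ) - 1) / (2 * d) := by
    rw [abs_sub_comm, abs_of_nonneg (by simp only [hu]; linarith [h01.2])]
    exact one_sub_descFactorial_div_pow_le hd j
  have h2 : ‖(γ j : ℂ) / (j ! : ℂ) * z ^ j‖ ≤ |γ j| / (j ! : ℝ) * R ^ j := by
    simp only [norm_mul, norm_div, Complex.norm_real, Complex.norm_natCast, norm_pow,
      Real.norm_eq_abs]
    gcongr
  have h3 : 0 ≤ (j : ℝ) * ((j : ℝ) - 1) / (2 * d) := (abs_nonneg _).trans h1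
  exact mul_le_mul h1 h2 (norm_nonneg _) h3

/-! ## Detection degree (quantitative Hurwitz via Rouché) -/

/-- **Detection of an isolated non-real zero by the Jensen polynomials.** Let `F(w) = Σ γⱼ wʲ/j!`
be entire with real coefficients, `z₀` a SIMPLE zero of `F` off the real axis which is the only zero
of `F` in the closed disc `‖z - z₀‖ ≤ ρ`, `0 < ρ ≤ |Im z₀|`, and `m ≤ |F|` on the circle
`‖z - z₀‖ = ρ`. Then for every degree `d ≥ 1` with `E_γ(‖z₀‖ + ρ)/(2d) < m` the Jensen polynomial
`J^{d,0}_γ` is NOT hyperbolic: by `norm_jensenPoly_scaled_sub_le` and Rouché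
(`Rouche.existsUnique_zero_of_norm_sub_lt`) `J^{d,0}_γ(z/d)` has a zero `u` with `‖u - z₀‖ < ρ`,
hence `Im u ≠ 0`. This is the effective converse direction of the Craven–Csordas/Chasse limit
theorems. [cite: Conway1978, Ch. VII Thm. 2.5 (Hurwitz)] -/
theorem not_splits_jensenPoly_of_offLine_zero {γ : ℕ → ℝ} {F : ℂ → ℂ}
    (hF : ∀ w : ℂ, HasSum (fun j => (γ j : ℂ) / (j ! : ℂ) * w ^ j) (F w))
    (hFd : Differentiable ℂ F)
    {z₀ : ℂ} {ρ m : ℝ} (hρ : 0 < ρ) (hρim : ρ ≤ |z₀.im|)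
    (hz₀ : F z₀ = 0) (hz₀' : deriv F z₀ ≠ 0)
    (huniq : ∀ v ∈ closedBall z₀ ρ, F v = 0 → v = z₀)
    (hm : ∀ z : ℂ, ‖z - z₀‖ = ρ → m ≤ ‖F z‖)
    (hsum : ∀ R : ℝ, 0 ≤ R → Summable fun j => |γ j| / (j ! : ℝ) * R ^ j)
    {d : ℕ} (hd : 0 < d)
    (herr : (∑' j : ℕ, ((j : ℝ) * ((j : ℝ) - 1)) * (|γ j| / (j ! : ℝ) * (‖z₀‖ + ρ) ^ j)) / (2 * d) < m) :
    ¬ (jensenPoly γ d 0).Splits := by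
  intro hs
  have hS := summable_majorantErr hsum (R := ‖z₀‖ + ρ) (by positivity)
  set f : ℂ → ℂ := fun z => aeval (z / d) (jensenPoly γ d 0) with hf
  have hfd : DifferentiableOn ℂ f (ball z₀ (ρ + 1)) :=
    ((Polynomial.differentiable_aeval (jensenPoly γ d 0)).comp
      (differentiable_id.div_const (d : ℂ))).differentiableOn
  have hgd : DifferentiableOn ℂ F (ball z₀ (ρ + 1)) := hFd.differentiableOn
  have hrou : ∀ z : ℂ, ‖z - z₀‖ = ρ → ‖f z - F z‖ < ‖F z‖ := by
    intro z hz
    have hzR : ‖z‖ ≤ ‖z₀‖ + ρ := by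
      calc ‖z‖ = ‖(z - z₀) + z₀‖ := by rw [sub_add_cancel]
        _ ≤ ‖z - z₀‖ + ‖z₀‖ := norm_add_le _ _
        _ = ‖z₀‖ + ρ := by rw [hz, add_comm]
    calc ‖f z - F z‖ ≤ (∑' j : ℕ, ((j : ℝ) * ((j : ℝ) - 1)) * (|γ j| / (j ! : ℝ) * (‖z₀‖ + ρ) ^ j)) / (2 * d) :=
          norm_jensenPoly_scaled_sub_le hF hd hzR hS
      _ < m := herr
      _ ≤ ‖F z‖ := hm z hz
  obtain ⟨u, hu, hfu, -, -⟩ := Rouche.existsUnique_zero_of_norm_sub_lt hρ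
    (by linarith : ρ < ρ + 1) hfd hgd hrou (mem_closedBall_self hρ.le) hz₀ hz₀' huniq
  have hJ0 : jensenPoly γ d 0 ≠ 0 := by
    intro h0
    have h1 := hrou (z₀ + ρ) (by simp [abs_of_pos hρ])
    simp [hf, h0] at h1
  have him : (u / (d : ℂ)).im = 0 := im_eq_zero_of_splits_of_aeval_eq_zero hs hJ0 hfu
  have huim : u.im = 0 := by
    rw [Complex.div_natCast_im] at him
    have hd' : (d : ℝ) ≠ 0 := by exact_mod_cast hd.ne'
    rcases div_eq_zero_iff.1 him with h | h
    · exact h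
    · exact absurd h hd'
  have h1 : |(u - z₀).im| ≤ ‖u - z₀‖ := Complex.abs_im_le_norm _
  rw [Complex.sub_im, huim, zero_sub, abs_neg] at h1
  linarith

end Literature.Analysis.Complex.JensenDetection
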